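import Literature.Analysis.FluidPDE.Vorticity
import Literature.Analysis.FluidPDE.TaoEnstrophyLocalisationProofs
import Mathlib.Analysis.SpecialFunctions.Sqrt
import Mathlib.Analysis.InnerProductSpace.Calculus
import Mathlib.Analysis.Calculus.Deriv.Inv
import HarnessLib

/-!
# Constantin's direction dissipation: the pointwise and slice calculus

Analysis/FluidPDE support file 1/2 for the discharge of the named fact
`Literature.Analysis.FluidPDE.constantin1990_direction_dissipation_bound`
(`ConstantinDirectionDissipation.lean`; P. Constantin, *Navier–Stokes equations and area of
interfaces*, Comm. Math. Phys. 129 (1990), §2). Constantin's device (op. cit., (1.3), (2.8)–(2.9),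
(2.13), (2.16)) is the change of dependent variable `w = q(τω)` with `q(y) = (1 + |y|²)^{1/2}`, a
smooth convex function with bounded gradient; in the variable `ε = 1/τ` this is the **regularised
modulus** `N_ε(ω) = √(|ω|² + ε²) = τ⁻¹ q(τω)`, and the positive Hessian term of (2.9) is the
regularised direction dissipation. This file provides, for a fixed time slice:

* the **pointwise stretching bound** `|⟪ω, (∇u) ω⟫| ≤ |ω| |∇u|²_F` for `ω = curl u`
  (`abs_inner_curlCLM_apply_le`, `abs_inner_curl_convect_le`; the bound `|∇u||ω|` of (2.7) after
  splitting `∇u` into symmetric and antisymmetric parts, `|ω|² = 2|A|²_F`, and Cauchy–Schwarz in the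
  nine entries), and `|curl u|² ≤ 2|∇u|²_F`;
* the calculus of `N_ε ∘ ω` (`hasFDerivAt_regN_comp`, `hasFDerivAt_inv_regN_comp`, …);
* the regularised density `Dreg_ε = Σᵢ (|∂ᵢω|²/N − ⟪ω, ∂ᵢω⟫²/N³) ≥ 0`, its lower envelope
  `Dlow_ε = Σᵢ (|∂ᵢω|²|ω|² − ⟪ω, ∂ᵢω⟫²)/N³` (`0 ≤ Dlow_ε ≤ Dreg_ε`, antitone in `ε`), and the
  identification of the exact density: `|ω| |∇ξ|²_F = Dlow_0`, `ξ = ω/|ω|` the vorticity direction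
  (`norm_mul_frobeniusNormSq_fderiv_vorticityDirection`, from the derivative of `ξ`,
  `hasFDerivAt_vorticityDirection`), with `ofReal Dlow_{1/(n+1)} ↑ ofReal Dlow_0`
  (`iSup_ofReal_dirDissLow_seq`);
* the three **slice identities** obtained by pairing `∂ₜω = νΔω − (u·∇)ω + (ω·∇)u` with
  `φ ω/N` for a compactly supported weight `φ` (the `ℝ³`-version of integrating (2.9) over the
  period box): the viscous identity `∫ φ⟪ω, Δω⟫/N = −∫ φ Dreg_ε + ∫ (Δφ)(N − c)`
  (`integral_mul_inner_laplacian_div_regN`, two integrations by parts from `WholeSpaceIBP`), the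
  transport identity `∫ φ⟪ω, (u·∇)ω⟫/N = −∫ (N − c)(u·∇)φ` for `div u = 0`
  (`integral_mul_inner_convect_div_regN`), and the stretching bound
  (`abs_mul_inner_stretch_div_regN_le`).

The space–time assembly (time integration, cutoff errors, limits `ε → 0`, `R → ∞`, `t → T`) is
file 2/2, `ConstantinDirectionDissipationProofs.lean`.

## Design notes

* No new definitions and no notation: the regularised modulus `N = √(|ω x|² + ε²)` and the two
  densities `Dreg`, `Dlow` are written out in every statement (closed Mathlib/Literature terms), so
  that the file is a pure proof file; the docstrings carry the readable form.
* The densities are written in the standard orthonormal basis `stdOrthonormalBasis ℝ ℝ³`, the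
  basis of `Literature.Analysis.FluidPDE.frobeniusNormSq`.

## References

* P. Constantin, *Navier–Stokes equations and area of interfaces*, Comm. Math. Phys. 129 (1990)
  241–266, §2: (2.5)–(2.9), (2.13)–(2.17). [Constantin1990]
* P. Constantin, *Near identity transformations for the Navier–Stokes equations*, Handbook of
  Mathematical Fluid Dynamics II (2003), §3 (the display with `ν|ω||∇ξ|²`).
-/

noncomputable section

open MeasureTheory Set Function Filter
open scoped RealInnerProductSpace ENNReal NNReal Laplacian Topology

namespace Literature.Analysis.FluidPDE

section Algebra

/-- **Algebraic core of the stretching bound.** For a real `3 × 3` array `m` (think `mᵢⱼ = ∂ⱼvᵢ`)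
and its curl vector `w = (m₂₁ − m₁₂, m₀₂ − m₂₀, m₁₀ − m₀₁)`, the quadratic form satisfies
`(wᵀ m w)² ≤ |w|² (Σ mᵢⱼ²)²`: symmetrise (`wᵀ m w = wᵀ S w`, `S = ½(m + mᵀ)`), apply Cauchy–Schwarz
in the nine entries, and use `Σ Sᵢⱼ² = Σ mᵢⱼ² − ½|w|²`. [folklore] -/
theorem sq_curlForm_le (m : Fin 3 → Fin 3 → ℝ) (w : Fin 3 → ℝ) (h0 : w 0 = m 2 1 - m 1 2)
    (h1 : w 1 = m 0 2 - m 2 0) (h2 : w 2 = m 1 0 - m 0 1) :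
    (∑ i, w i * ∑ j, w j * m i j) ^ 2 ≤ (∑ i, w i ^ 2) * (∑ j, ∑ i, m i j ^ 2) ^ 2 := by
  set S2 : ℝ := ∑ i, ∑ j, ((m i j + m j i) / 2) ^ 2 with hS2def
  set F : ℝ := ∑ j, ∑ i, m i j ^ 2 with hFdef
  set r2 : ℝ := ∑ i, w i ^ 2 with hr2def
  have hCS : (∑ i, w i * ∑ j, w j * m i j) ^ 2 ≤ S2 * r2 ^ 2 := by
    have e1 : ∑ i, w i * ∑ j, w j * m i j =
        ∑ p : Fin 3 × Fin 3, ((m p.1 p.2 + m p.2 p.1) / 2) * (w p.1 * w p.2) := by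
      simp only [Fintype.sum_prod_type, Fin.sum_univ_three]
      ring
    have e2 : ∑ p : Fin 3 × Fin 3, (w p.1 * w p.2) ^ 2 = r2 ^ 2 := by
      simp only [Fintype.sum_prod_type, Fin.sum_univ_three, hr2def]
      ring
    have e3 : ∑ p : Fin 3 × Fin 3, ((m p.1 p.2 + m p.2 p.1) / 2) ^ 2 = S2 := by
      simp only [Fintype.sum_prod_type, hS2def]
    rw [e1, ← e2, ← e3]
    exact Finset.sum_mul_sq_le_sq_mul_sq _ _ _
  have hS2 : S2 = F - r2 / 2 := by
    simp only [hS2def, hFdef, hr2def, Fin.sum_univ_three, h0, h1, h2]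
    ring
  have hr2 : 0 ≤ r2 := Finset.sum_nonneg fun i _ => sq_nonneg _
  have key : S2 * r2 ^ 2 ≤ r2 * F ^ 2 := by
    rw [hS2]
    have hid : r2 * F ^ 2 - (F - r2 / 2) * r2 ^ 2 = r2 * ((F - r2 / 2) ^ 2 + r2 ^ 2 / 4) := by ring
    have hnn : 0 ≤ r2 * ((F - r2 / 2) ^ 2 + r2 ^ 2 / 4) := by positivity
    linarith
  calc (∑ i, w i * ∑ j, w j * m i j) ^ 2 ≤ S2 * r2 ^ 2 := hCS
    _ ≤ r2 * F ^ 2 := key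

/-- `|w|² ≤ 2 Σ mᵢⱼ²` for the curl vector `w` of a real `3 × 3` array `m`
(`2 Σ mᵢⱼ² − |w|² = ½ Σ (mᵢⱼ + mⱼᵢ)² ≥ 0`). [folklore] -/
theorem curlForm_normSq_le (m : Fin 3 → Fin 3 → ℝ) (w : Fin 3 → ℝ) (h0 : w 0 = m 2 1 - m 1 2)
    (h1 : w 1 = m 0 2 - m 2 0) (h2 : w 2 = m 1 0 - m 0 1) :
    ∑ i, w i ^ 2 ≤ 2 * ∑ j, ∑ i, m i j ^ 2 := by
  have hS2 : ∑ i, ∑ j, ((m i j + m j i) / 2) ^ 2 = (∑ j, ∑ i, m i j ^ 2) - (∑ i, w i ^ 2) / 2 := by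
    simp only [Fin.sum_univ_three, h0, h1, h2]
    ring
  have hnn : 0 ≤ ∑ i, ∑ j, ((m i j + m j i) / 2) ^ 2 :=
    Finset.sum_nonneg fun i _ => Finset.sum_nonneg fun j _ => sq_nonneg _
  linarith

/-- Coordinates of the curl vector `curlCLM L` in terms of the entries `(L eⱼ)ᵢ`. [folklore] -/
theorem curlCLM_apply_coord (L : (EuclideanSpace ℝ (Fin 3)) →L[ℝ] (EuclideanSpace ℝ (Fin 3))) :
    curlCLM L 0 = L ((EuclideanSpace.basisFun (Fin 3) ℝ) 1) 2 - L ((EuclideanSpace.basisFun (Fin 3) ℝ) 2) 1 ∧ curlCLM L 1 = L ((EuclideanSpace.basisFun (Fin 3) ℝ) 2) 0 - L ((EuclideanSpace.basisFun (Fin 3) ℝ) 0) 2 ∧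
      curlCLM L 2 = L ((EuclideanSpace.basisFun (Fin 3) ℝ) 0) 1 - L ((EuclideanSpace.basisFun (Fin 3) ℝ) 1) 0 := by
  simp [curlCLM, curlLM, EuclideanSpace.basisFun_apply]

/-- The Frobenius norm as the sum of the squared entries `(L eⱼ)ᵢ²`. [folklore] -/
theorem frobeniusNormSq_eq_sum_sq_coord (L : (EuclideanSpace ℝ (Fin 3)) →L[ℝ] (EuclideanSpace ℝ (Fin 3))) :
    frobeniusNormSq L = ∑ j, ∑ i, (L ((EuclideanSpace.basisFun (Fin 3) ℝ) j) i) ^ 2 := by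
  rw [frobeniusNormSq_eq_sum (EuclideanSpace.basisFun (Fin 3) ℝ)]
  refine Finset.sum_congr rfl fun j _ => ?_
  rw [EuclideanSpace.norm_sq_eq]
  simp [Real.norm_eq_abs, sq_abs]

/-- **Pointwise stretching bound, squared form**: for every linear `L : ℝ³ → ℝ³` with curl vector
`ω = curlCLM L`, `⟪ω, L ω⟫² ≤ |ω|² |L|⁴_F` (`|·|_F` the Frobenius norm). [folklore] -/
theorem sq_inner_curlCLM_apply_le (L : (EuclideanSpace ℝ (Fin 3)) →L[ℝ] (EuclideanSpace ℝ (Fin 3))) :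
    ⟪curlCLM L, L (curlCLM L)⟫ ^ 2 ≤ ‖curlCLM L‖ ^ 2 * frobeniusNormSq L ^ 2 := by
  set ω := curlCLM L with hωdef
  have hexp : ∀ y : (EuclideanSpace ℝ (Fin 3)), y = ∑ j, y j • ((EuclideanSpace.basisFun (Fin 3) ℝ) j : (EuclideanSpace ℝ (Fin 3))) := fun y => (((EuclideanSpace.basisFun (Fin 3) ℝ)).sum_repr y).symm
  have hL : ∀ i, (L ω) i = ∑ j, ω j * L ((EuclideanSpace.basisFun (Fin 3) ℝ) j) i := by
    intro i
    conv_lhs => rw [hexp ω, map_sum]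
    simp [map_smul]
  have hinner : ⟪ω, L ω⟫ = ∑ i, ω i * ∑ j, ω j * L ((EuclideanSpace.basisFun (Fin 3) ℝ) j) i := by
    rw [PiLp.inner_apply]
    refine Finset.sum_congr rfl fun i _ => ?_
    rw [hL i]
    simp [mul_comm]
  have hnorm : ‖ω‖ ^ 2 = ∑ i, ω i ^ 2 := by
    rw [EuclideanSpace.norm_sq_eq]
    simp [Real.norm_eq_abs, sq_abs]
  obtain ⟨h0, h1, h2⟩ := curlCLM_apply_coord L
  rw [hinner, hnorm, frobeniusNormSq_eq_sum_sq_coord]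
  exact sq_curlForm_le (fun i j => L ((EuclideanSpace.basisFun (Fin 3) ℝ) j) i) (fun i => ω i) h0 h1 h2

/-- **Pointwise stretching bound**: `|⟪ω, L ω⟫| ≤ |ω| |L|²_F` for `ω = curlCLM L` — the vortex
stretching `ξ · S ξ |ω|²` is at most `|ω|` times the local dissipation density `|∇u|²` (with room:
the sharp constant is `1/√2`). [folklore] -/
theorem abs_inner_curlCLM_apply_le (L : (EuclideanSpace ℝ (Fin 3)) →L[ℝ] (EuclideanSpace ℝ (Fin 3))) :
    |⟪curlCLM L, L (curlCLM L)⟫| ≤ ‖curlCLM L‖ * frobeniusNormSq L := by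
  have h := sq_inner_curlCLM_apply_le L
  have hnn : 0 ≤ ‖curlCLM L‖ * frobeniusNormSq L :=
    mul_nonneg (norm_nonneg _) (frobeniusNormSq_nonneg L)
  rw [← mul_pow] at h
  exact abs_le_of_sq_le_sq' h hnn |> fun h' => abs_le.2 h'

/-- `|curl|² ≤ 2 |L|²_F` for `ω = curlCLM L`. [folklore] -/
theorem norm_curlCLM_sq_le (L : (EuclideanSpace ℝ (Fin 3)) →L[ℝ] (EuclideanSpace ℝ (Fin 3))) : ‖curlCLM L‖ ^ 2 ≤ 2 * frobeniusNormSq L := by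
  have hnorm : ‖curlCLM L‖ ^ 2 = ∑ i, (curlCLM L) i ^ 2 := by
    rw [EuclideanSpace.norm_sq_eq]
    simp [Real.norm_eq_abs, sq_abs]
  obtain ⟨h0, h1, h2⟩ := curlCLM_apply_coord L
  rw [hnorm, frobeniusNormSq_eq_sum_sq_coord]
  exact curlForm_normSq_le (fun i j => L ((EuclideanSpace.basisFun (Fin 3) ℝ) j) i) (fun i => curlCLM L i) h0 h1 h2

/-- `|curl v(x)|² ≤ 2 |∇v(x)|²_F` pointwise. [folklore] -/
theorem norm_curl_sq_le_two_mul_frobeniusNormSq (v : (EuclideanSpace ℝ (Fin 3)) → (EuclideanSpace ℝ (Fin 3))) (x : (EuclideanSpace ℝ (Fin 3))) :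
    ‖curl v x‖ ^ 2 ≤ 2 * frobeniusNormSq (fderiv ℝ v x) := by
  rw [curl_eq_curlCLM]
  exact norm_curlCLM_sq_le _

/-- The vortex-stretching density is dominated by `|ω| |∇v|²_F`:
`|⟪ω, (ω·∇)v⟫| ≤ |ω| |∇v|²_F` pointwise, `ω = curl v` (Constantin 1990, the bound
`(ω·∇u)·ω ≤ |∇u||ω|²` behind (2.7), sharpened by the symmetric/antisymmetric splitting). [folklore] -/
theorem abs_inner_curl_convect_le (v : (EuclideanSpace ℝ (Fin 3)) → (EuclideanSpace ℝ (Fin 3))) (x : (EuclideanSpace ℝ (Fin 3))) :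
    |⟪curl v x, fderiv ℝ v x (curl v x)⟫| ≤ ‖curl v x‖ * frobeniusNormSq (fderiv ℝ v x) := by
  rw [curl_eq_curlCLM]
  exact abs_inner_curlCLM_apply_le _

end Algebra

section RegN

variable {F' : Type*} [NormedAddCommGroup F']

/-- `0 ≤ √(|v|² + ε²)`. [folklore] -/
theorem regN_nonneg (ε : ℝ) (v : F') : 0 ≤ Real.sqrt (‖v‖ ^ 2 + ε ^ 2) := Real.sqrt_nonneg _

/-- `(√(|v|² + ε²))² = |v|² + ε²`. [folklore] -/
theorem regN_sq (ε : ℝ) (v : F') : (Real.sqrt (‖v‖ ^ 2 + ε ^ 2)) ^ 2 = ‖v‖ ^ 2 + ε ^ 2 :=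
  Real.sq_sqrt (by positivity)

/-- `|v| ≤ √(|v|² + ε²)`. [folklore] -/
theorem norm_le_regN (ε : ℝ) (v : F') : ‖v‖ ≤ Real.sqrt (‖v‖ ^ 2 + ε ^ 2) :=
  Real.le_sqrt_of_sq_le (by nlinarith [sq_nonneg ε])

/-- `|ε| ≤ √(|v|² + ε²)`. [folklore] -/
theorem abs_le_regN (ε : ℝ) (v : F') : |ε| ≤ Real.sqrt (‖v‖ ^ 2 + ε ^ 2) :=
  Real.abs_le_sqrt (by nlinarith [sq_nonneg ‖v‖])

/-- `√(|v|² + ε²) > 0` for `ε ≠ 0`. [folklore] -/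
theorem regN_pos {ε : ℝ} (hε : ε ≠ 0) (v : F') : 0 < Real.sqrt (‖v‖ ^ 2 + ε ^ 2) :=
  (abs_pos.2 hε).trans_le (abs_le_regN ε v)

/-- `√(|v|² + ε²) − ε ≤ |v|` for `ε ≥ 0`. [folklore] -/
theorem regN_sub_le_norm {ε : ℝ} (hε : 0 ≤ ε) (v : F') : Real.sqrt (‖v‖ ^ 2 + ε ^ 2) - ε ≤ ‖v‖ := by
  rw [sub_le_iff_le_add, Real.sqrt_le_left (by positivity)]
  nlinarith [norm_nonneg v]

/-- `0 ≤ √(|v|² + ε²) − ε` for `ε ≥ 0`. [folklore] -/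
theorem regN_sub_nonneg {ε : ℝ} (hε : 0 ≤ ε) (v : F') : 0 ≤ Real.sqrt (‖v‖ ^ 2 + ε ^ 2) - ε := by
  have := abs_le_regN ε v
  rw [abs_of_nonneg hε] at this
  linarith

/-- `√(|v|² + 0²) = |v|`. [folklore] -/
theorem regN_zero (v : F') : Real.sqrt (‖v‖ ^ 2 + ((0 : ℝ)) ^ 2) = ‖v‖ := by
  rw [zero_pow two_ne_zero, add_zero, Real.sqrt_sq (norm_nonneg v)]

/-- Monotonicity of the regularised modulus in `|ε|`. [folklore] -/
theorem regN_mono {ε₁ ε₂ : ℝ} (h : |ε₁| ≤ |ε₂|) (v : F') : Real.sqrt (‖v‖ ^ 2 + (ε₁) ^ 2) ≤ Real.sqrt (‖v‖ ^ 2 + (ε₂) ^ 2) := by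
  refine Real.sqrt_le_sqrt ?_
  have : ε₁ ^ 2 ≤ ε₂ ^ 2 := by
    rw [← sq_abs ε₁, ← sq_abs ε₂]
    exact pow_le_pow_left₀ (abs_nonneg _) h 2
  linarith

/-- `ε ↦ √(|v|² + ε²)` is continuous, with value `|v|` at `ε = 0`. [folklore] -/
theorem tendsto_regN_zero (v : F') : Tendsto (fun ε : ℝ => Real.sqrt (‖v‖ ^ 2 + ε ^ 2)) (𝓝 0) (𝓝 ‖v‖) := by
  have hc : Continuous fun ε : ℝ => Real.sqrt (‖v‖ ^ 2 + ε ^ 2) := by fun_prop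
  have := hc.tendsto 0
  rwa [regN_zero] at this

variable [InnerProductSpace ℝ F']

/-- The regularised modulus `v ↦ √(|v|² + ε²)` is smooth for `ε ≠ 0`. [folklore] -/
theorem contDiff_regN {ε : ℝ} (hε : ε ≠ 0) {n : WithTop ℕ∞} :
    ContDiff ℝ n (fun v : F' => Real.sqrt (‖v‖ ^ 2 + ε ^ 2)) :=
  ((contDiff_norm_sq ℝ).add contDiff_const).sqrt fun v => by positivity

/-- **Chain rule for the regularised modulus**: if `ω` has derivative `ω'` at `x` and
`|ω(x)|² + ε² ≠ 0`, then `y ↦ √(|ω(y)|² + ε²)` has derivative `h ↦ ⟪ω(x), ω' h⟫ / √(|ω(x)|² + ε²)`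
at `x`. [folklore] -/
theorem hasFDerivAt_regN_comp {E' : Type*} [NormedAddCommGroup E'] [NormedSpace ℝ E']
    {ω : E' → F'} {ω' : E' →L[ℝ] F'} {x : E'} (h : HasFDerivAt ω ω' x) {ε : ℝ}
    (hne : ‖ω x‖ ^ 2 + ε ^ 2 ≠ 0) :
    HasFDerivAt (fun y => Real.sqrt (‖ω y‖ ^ 2 + ε ^ 2)) ((Real.sqrt (‖ω x‖ ^ 2 + ε ^ 2))⁻¹ • (innerSL ℝ (ω x)).comp ω') x := by
  have h1 : HasFDerivAt (fun y => ‖ω y‖ ^ 2 + ε ^ 2) (2 • (innerSL ℝ (ω x)).comp ω') x :=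
    h.norm_sq.add_const _
  have h2 := h1.sqrt hne
  have hN : Real.sqrt (‖ω x‖ ^ 2 + ε ^ 2) ≠ 0 := by
    have hpos : 0 < ‖ω x‖ ^ 2 + ε ^ 2 := lt_of_le_of_ne (by positivity) (Ne.symm hne)
    exact (Real.sqrt_pos.2 hpos).ne'
  convert h2 using 1
  ext v
  simp
  field_simp

/-- Applied form of `hasFDerivAt_regN_comp`:
`D(√(|ω|² + ε²))(x) h = ⟪ω(x), Dω(x) h⟫ / √(|ω(x)|² + ε²)`. [folklore] -/
theorem fderiv_regN_comp_apply {E' : Type*} [NormedAddCommGroup E'] [NormedSpace ℝ E']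
    {ω : E' → F'} {x : E'} (h : DifferentiableAt ℝ ω x) {ε : ℝ}
    (hne : ‖ω x‖ ^ 2 + ε ^ 2 ≠ 0) (v : E') :
    fderiv ℝ (fun y => Real.sqrt (‖ω y‖ ^ 2 + ε ^ 2)) x v = ⟪ω x, fderiv ℝ ω x v⟫ / Real.sqrt (‖ω x‖ ^ 2 + ε ^ 2) := by
  rw [(hasFDerivAt_regN_comp h.hasFDerivAt hne).fderiv]
  simp [div_eq_inv_mul]

/-- Differentiability of `y ↦ √(|ω(y)|² + ε²)`. [folklore] -/
theorem differentiableAt_regN_comp {E' : Type*} [NormedAddCommGroup E'] [NormedSpace ℝ E']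
    {ω : E' → F'} {x : E'} (h : DifferentiableAt ℝ ω x) {ε : ℝ}
    (hne : ‖ω x‖ ^ 2 + ε ^ 2 ≠ 0) : DifferentiableAt ℝ (fun y => Real.sqrt (‖ω y‖ ^ 2 + ε ^ 2)) x :=
  (hasFDerivAt_regN_comp h.hasFDerivAt hne).differentiableAt

/-- **Chain rule for the inverse regularised modulus**:
`D(1/√(|ω|² + ε²))(x) h = −⟪ω(x), Dω(x) h⟫ / √(|ω(x)|² + ε²)³`. [folklore] -/
theorem hasFDerivAt_inv_regN_comp {E' : Type*} [NormedAddCommGroup E'] [NormedSpace ℝ E']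
    {ω : E' → F'} {ω' : E' →L[ℝ] F'} {x : E'} (h : HasFDerivAt ω ω' x) {ε : ℝ}
    (hne : ‖ω x‖ ^ 2 + ε ^ 2 ≠ 0) :
    HasFDerivAt (fun y => (Real.sqrt (‖ω y‖ ^ 2 + ε ^ 2))⁻¹)
      ((-(Real.sqrt (‖ω x‖ ^ 2 + ε ^ 2) ^ 3)⁻¹) • (innerSL ℝ (ω x)).comp ω') x := by
  have hN : Real.sqrt (‖ω x‖ ^ 2 + ε ^ 2) ≠ 0 := by
    have hpos : 0 < ‖ω x‖ ^ 2 + ε ^ 2 := lt_of_le_of_ne (by positivity) (Ne.symm hne)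
    exact (Real.sqrt_pos.2 hpos).ne'
  have h1 : HasFDerivAt (fun y => (Real.sqrt (‖ω y‖ ^ 2 + ε ^ 2))⁻¹)
      ((ContinuousLinearMap.toSpanSingleton ℝ (-(Real.sqrt (‖ω x‖ ^ 2 + ε ^ 2) ^ 2)⁻¹)).comp
        ((Real.sqrt (‖ω x‖ ^ 2 + ε ^ 2))⁻¹ • (innerSL ℝ (ω x)).comp ω')) x :=
    (hasFDerivAt_inv hN).comp x (hasFDerivAt_regN_comp h hne)
  refine h1.congr_fderiv ?_
  ext v
  simp
  ring

end RegN

/-! ### The regularised and the exact direction-dissipation densities: pointwise comparison -/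

section Pointwise

/-- The numerator `Σᵢ (|∂ᵢω|²|ω|² − ⟪ω, ∂ᵢω⟫²)` is nonnegative (Cauchy–Schwarz). [folklore] -/
theorem dirDiss_num_nonneg (ω : (EuclideanSpace ℝ (Fin 3)) → (EuclideanSpace ℝ (Fin 3))) (x : (EuclideanSpace ℝ (Fin 3))) :
    0 ≤ ∑ i, (‖fderiv ℝ ω x (stdOrthonormalBasis ℝ (EuclideanSpace ℝ (Fin 3)) i)‖ ^ 2 * ‖ω x‖ ^ 2
      - ⟪ω x, fderiv ℝ ω x (stdOrthonormalBasis ℝ (EuclideanSpace ℝ (Fin 3)) i)⟫ ^ 2) := by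
  refine Finset.sum_nonneg fun i _ => ?_
  have h := abs_real_inner_le_norm (ω x) (fderiv ℝ ω x (stdOrthonormalBasis ℝ (EuclideanSpace ℝ (Fin 3)) i))
  have h2 : ⟪ω x, fderiv ℝ ω x (stdOrthonormalBasis ℝ (EuclideanSpace ℝ (Fin 3)) i)⟫ ^ 2 ≤
      (‖ω x‖ * ‖fderiv ℝ ω x (stdOrthonormalBasis ℝ (EuclideanSpace ℝ (Fin 3)) i)‖) ^ 2 := by
    rw [← sq_abs]
    exact pow_le_pow_left₀ (abs_nonneg _) h 2
  nlinarith [h2]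

/-- The lower density `Dlow` is nonnegative. [folklore] -/
theorem dirDissLow_nonneg (ε : ℝ) (ω : (EuclideanSpace ℝ (Fin 3)) → (EuclideanSpace ℝ (Fin 3))) (x : (EuclideanSpace ℝ (Fin 3))) : 0 ≤ ((∑ i, (‖fderiv ℝ ω x ((stdOrthonormalBasis ℝ (EuclideanSpace ℝ (Fin 3))) i)‖ ^ 2 * ‖ω x‖ ^ 2 - ⟪ω x, fderiv ℝ ω x ((stdOrthonormalBasis ℝ (EuclideanSpace ℝ (Fin 3))) i)⟫ ^ 2)) / Real.sqrt (‖ω x‖ ^ 2 + ε ^ 2) ^ 3) :=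
  div_nonneg (dirDiss_num_nonneg ω x) (pow_nonneg (regN_nonneg _ _) 3)

/-- **`Dlow ≤ Dreg`**: the lower density is dominated by the regularised direction dissipation
`Σᵢ (|∂ᵢω|²/N − ⟪ω, ∂ᵢω⟫²/N³)`, `N = √(|ω|² + ε²)` (since `|ω|² ≤ N²`). [folklore] -/
theorem dirDissLow_le_dirDissReg {ε : ℝ} (hε : ε ≠ 0) (ω : (EuclideanSpace ℝ (Fin 3)) → (EuclideanSpace ℝ (Fin 3))) (x : (EuclideanSpace ℝ (Fin 3))) :
    ((∑ i, (‖fderiv ℝ ω x ((stdOrthonormalBasis ℝ (EuclideanSpace ℝ (Fin 3))) i)‖ ^ 2 * ‖ω x‖ ^ 2 - ⟪ω x, fderiv ℝ ω x ((stdOrthonormalBasis ℝ (EuclideanSpace ℝ (Fin 3))) i)⟫ ^ 2)) / Real.sqrt (‖ω x‖ ^ 2 + ε ^ 2) ^ 3) ≤ (∑ i, (‖fderiv ℝ ω x ((stdOrthonormalBasis ℝ (EuclideanSpace ℝ (Fin 3))) i)‖ ^ 2 / Real.sqrt (‖ω x‖ ^ 2 + ε ^ 2) - ⟪ω x, fderiv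 ℝ ω x ((stdOrthonormalBasis ℝ (EuclideanSpace ℝ (Fin 3))) i)⟫ ^ 2 / Real.sqrt (‖ω x‖ ^ 2 + ε ^ 2) ^ 3)) := by
  have hN := regN_pos hε (ω x)
  rw [Finset.sum_div]
  refine Finset.sum_le_sum fun i _ => ?_
  rw [sub_div]
  refine sub_le_sub_right ?_ _
  rw [div_le_div_iff₀ (pow_pos hN 3) hN]
  have hle : ‖ω x‖ ^ 2 ≤ Real.sqrt (‖ω x‖ ^ 2 + ε ^ 2) ^ 2 := by
    rw [regN_sq]; nlinarith [sq_nonneg ε]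
  have hp : 0 ≤ ‖fderiv ℝ ω x (stdOrthonormalBasis ℝ (EuclideanSpace ℝ (Fin 3)) i)‖ ^ 2 := sq_nonneg _
  calc ‖fderiv ℝ ω x (stdOrthonormalBasis ℝ (EuclideanSpace ℝ (Fin 3)) i)‖ ^ 2 * ‖ω x‖ ^ 2 * Real.sqrt (‖ω x‖ ^ 2 + ε ^ 2)
      ≤ ‖fderiv ℝ ω x (stdOrthonormalBasis ℝ (EuclideanSpace ℝ (Fin 3)) i)‖ ^ 2 * Real.sqrt (‖ω x‖ ^ 2 + ε ^ 2) ^ 2 * Real.sqrt (‖ω x‖ ^ 2 + ε ^ 2) := by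
        gcongr
    _ = ‖fderiv ℝ ω x (stdOrthonormalBasis ℝ (EuclideanSpace ℝ (Fin 3)) i)‖ ^ 2 * Real.sqrt (‖ω x‖ ^ 2 + ε ^ 2) ^ 3 := by ring

/-- `Dlow` is antitone in `|ε|` (the numerator does not depend on `ε`, the denominator
`N³` is monotone). [folklore] -/
theorem dirDissLow_antitone {ε₁ ε₂ : ℝ} (h₁ : ε₁ ≠ 0) (h : |ε₁| ≤ |ε₂|) (ω : (EuclideanSpace ℝ (Fin 3)) → (EuclideanSpace ℝ (Fin 3))) (x : (EuclideanSpace ℝ (Fin 3))) :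
    ((∑ i, (‖fderiv ℝ ω x ((stdOrthonormalBasis ℝ (EuclideanSpace ℝ (Fin 3))) i)‖ ^ 2 * ‖ω x‖ ^ 2 - ⟪ω x, fderiv ℝ ω x ((stdOrthonormalBasis ℝ (EuclideanSpace ℝ (Fin 3))) i)⟫ ^ 2)) / Real.sqrt (‖ω x‖ ^ 2 + (ε₂) ^ 2) ^ 3) ≤ ((∑ i, (‖fderiv ℝ ω x ((stdOrthonormalBasis ℝ (EuclideanSpace ℝ (Fin 3))) i)‖ ^ 2 * ‖ω x‖ ^ 2 - ⟪ω x, fderiv ℝ ω x ((stdOrthonormalBasis ℝ (EuclideanSpace ℝ (Fin 3))) i)⟫ ^ 2)) / Real.sqrt (‖ω x‖ ^ 2 + (ε₁) ^ 2) ^ 3) := by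
  refine div_le_div_of_nonneg_left (dirDiss_num_nonneg ω x) (pow_pos (regN_pos h₁ _) 3) ?_
  exact pow_le_pow_left₀ (regN_nonneg _ _) (regN_mono h (ω x)) 3

/-- `Dlow[ε] → Dlow[0]` as `ε → 0`. [folklore] -/
theorem tendsto_dirDissLow (ω : (EuclideanSpace ℝ (Fin 3)) → (EuclideanSpace ℝ (Fin 3))) (x : (EuclideanSpace ℝ (Fin 3))) :
    Tendsto (fun ε : ℝ => ((∑ i, (‖fderiv ℝ ω x ((stdOrthonormalBasis ℝ (EuclideanSpace ℝ (Fin 3))) i)‖ ^ 2 * ‖ω x‖ ^ 2 - ⟪ω x, fderiv ℝ ω x ((stdOrthonormalBasis ℝ (EuclideanSpace ℝ (Fin 3))) i)⟫ ^ 2)) / Real.sqrt (‖ω x‖ ^ 2 + ε ^ 2) ^ 3)) (𝓝 0) (𝓝 (((∑ i, (‖fderiv ℝ ω x ((stdOrthonormalBasis ℝ (EuclideanSpace ℝ (Fin 3))) i)‖ ^ 2 * ‖ω x‖ ^ 2 - ⟪ω x, fderiv ℝ ω x ((stdOrthonormalBasis ℝ (EuclideanSpace ℝ (Fin 3))) i)⟫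 ^ 2)) / Real.sqrt (‖ω x‖ ^ 2 + ((0 : ℝ)) ^ 2) ^ 3))) := by
  by_cases hx : ω x = 0
  · have hnum : ∑ i, (‖fderiv ℝ ω x (stdOrthonormalBasis ℝ (EuclideanSpace ℝ (Fin 3)) i)‖ ^ 2 * ‖ω x‖ ^ 2
        - ⟪ω x, fderiv ℝ ω x (stdOrthonormalBasis ℝ (EuclideanSpace ℝ (Fin 3)) i)⟫ ^ 2) = 0 := by
      simp [hx]
    simp only [hnum, zero_div]
    exact tendsto_const_nhds
  · refine Tendsto.div tendsto_const_nhds ((tendsto_regN_zero (ω x)).pow 3 |>.congr' ?_ |>.trans ?_) ?_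
    · exact Eventually.of_forall fun ε => rfl
    · rw [regN_zero]
    · rw [regN_zero]
      exact pow_ne_zero 3 (norm_ne_zero_iff.2 hx)

/-- Along `εₙ = 1/(n+1)` the lower densities increase … [folklore] -/
theorem monotone_dirDissLow_seq (ω : (EuclideanSpace ℝ (Fin 3)) → (EuclideanSpace ℝ (Fin 3))) (x : (EuclideanSpace ℝ (Fin 3))) :
    Monotone fun n : ℕ => ((∑ i, (‖fderiv ℝ ω x ((stdOrthonormalBasis ℝ (EuclideanSpace ℝ (Fin 3))) i)‖ ^ 2 * ‖ω x‖ ^ 2 - ⟪ω x, fderiv ℝ ω x ((stdOrthonormalBasis ℝ (EuclideanSpace ℝ (Fin 3))) i)⟫ ^ 2)) / Real.sqrt (‖ω x‖ ^ 2 + (((n : ℝ) + 1)⁻¹) ^ 2) ^ 3) := by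
  refine monotone_nat_of_le_succ fun n => ?_
  have h1 : (((n + 1 : ℕ) : ℝ) + 1)⁻¹ ≠ 0 := by positivity
  refine dirDissLow_antitone h1 ?_ ω x
  rw [abs_of_pos (by positivity), abs_of_pos (by positivity)]
  gcongr
  linarith

/-- … and converge to the exact density `Dlow[0]`. [folklore] -/
theorem tendsto_dirDissLow_seq (ω : (EuclideanSpace ℝ (Fin 3)) → (EuclideanSpace ℝ (Fin 3))) (x : (EuclideanSpace ℝ (Fin 3))) :
    Tendsto (fun n : ℕ => ((∑ i, (‖fderiv ℝ ω x ((stdOrthonormalBasis ℝ (EuclideanSpace ℝ (Fin 3))) i)‖ ^ 2 * ‖ω x‖ ^ 2 - ⟪ω x, fderiv ℝ ω x ((stdOrthonormalBasis ℝ (EuclideanSpace ℝ (Fin 3))) i)⟫ ^ 2)) / Real.sqrt (‖ω x‖ ^ 2 + (((n : ℝ) + 1)⁻¹) ^ 2) ^ 3)) atTop (𝓝 (((∑ i, (‖fderiv ℝ ω x ((stdOrthonormalBasis ℝ (EuclideanSpace ℝ (Fin 3))) i)‖ ^ 2 * ‖ω x‖ ^ 2 - ⟪ω x, fderiv ℝ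 ω x ((stdOrthonormalBasis ℝ (EuclideanSpace ℝ (Fin 3))) i)⟫ ^ 2)) / Real.sqrt (‖ω x‖ ^ 2 + ((0 : ℝ)) ^ 2) ^ 3))) :=
  (tendsto_dirDissLow ω x).comp <| by
    simpa only [one_div] using tendsto_one_div_add_atTop_nhds_zero_nat (𝕜 := ℝ)

/-! ### The exact density: `|ω| |∇ξ|²_F = Dlow[0]` -/

/-- **Derivative of the direction field** `ξ = ω/|ω|` at a point where `ω ≠ 0`:
`Dξ(x) h = Dω(x) h/|ω| − (⟪ω, Dω(x) h⟫/|ω|³) ω`. [folklore] -/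
theorem hasFDerivAt_vorticityDirection {ω : (EuclideanSpace ℝ (Fin 3)) → (EuclideanSpace ℝ (Fin 3))} {ω' : (EuclideanSpace ℝ (Fin 3)) →L[ℝ] (EuclideanSpace ℝ (Fin 3))} {x : (EuclideanSpace ℝ (Fin 3))}
    (h : HasFDerivAt ω ω' x) (hx : ω x ≠ 0) :
    HasFDerivAt (vorticityDirection ω)
      (‖ω x‖⁻¹ • ω' + ((-(‖ω x‖ ^ 3)⁻¹) • (innerSL ℝ (ω x)).comp ω').smulRight (ω x)) x := by
  have hne : ‖ω x‖ ^ 2 + (0 : ℝ) ^ 2 ≠ 0 := by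
    have : 0 < ‖ω x‖ := norm_pos_iff.2 hx
    positivity
  have hinv : HasFDerivAt (fun y => ‖ω y‖⁻¹) ((-(‖ω x‖ ^ 3)⁻¹) • (innerSL ℝ (ω x)).comp ω') x := by
    simpa only [regN_zero] using hasFDerivAt_inv_regN_comp h hne
  have hdef : vorticityDirection ω = fun y => ‖ω y‖⁻¹ • ω y := rfl
  rw [hdef]
  exact hinv.smul h

/-- Applied form: `Dξ(x) e = Dω(x) e/|ω| − (⟪ω, Dω(x) e⟫/|ω|³) ω` for `ω(x) ≠ 0`. [folklore] -/
theorem fderiv_vorticityDirection_apply {ω : (EuclideanSpace ℝ (Fin 3)) → (EuclideanSpace ℝ (Fin 3))} {x : (EuclideanSpace ℝ (Fin 3))} (h : DifferentiableAt ℝ ω x)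
    (hx : ω x ≠ 0) (e : (EuclideanSpace ℝ (Fin 3))) :
    fderiv ℝ (vorticityDirection ω) x e =
      ‖ω x‖⁻¹ • fderiv ℝ ω x e - ((‖ω x‖ ^ 3)⁻¹ * ⟪ω x, fderiv ℝ ω x e⟫) • ω x := by
  rw [(hasFDerivAt_vorticityDirection h.hasFDerivAt hx).fderiv]
  simp [sub_eq_add_neg, neg_smul]

/-- `|ω| |Dξ(x) e|² = (|Dω e|² |ω|² − ⟪ω, Dω e⟫²)/|ω|³` for `ω(x) ≠ 0` (expand the square, using
`⟪ξ, ∂ξ⟫ = 0` in the form `|a Dω e − b ω|² = a²|Dω e|² − 2ab⟪Dω e, ω⟫ + b²|ω|²`). [folklore] -/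
theorem norm_mul_norm_sq_fderiv_vorticityDirection_apply {ω : (EuclideanSpace ℝ (Fin 3)) → (EuclideanSpace ℝ (Fin 3))} {x : (EuclideanSpace ℝ (Fin 3))}
    (h : DifferentiableAt ℝ ω x) (hx : ω x ≠ 0) (e : (EuclideanSpace ℝ (Fin 3))) :
    ‖ω x‖ * ‖fderiv ℝ (vorticityDirection ω) x e‖ ^ 2 =
      (‖fderiv ℝ ω x e‖ ^ 2 * ‖ω x‖ ^ 2 - ⟪ω x, fderiv ℝ ω x e⟫ ^ 2) / ‖ω x‖ ^ 3 := by
  have hr : ‖ω x‖ ≠ 0 := norm_ne_zero_iff.2 hx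
  rw [fderiv_vorticityDirection_apply h hx e, norm_sub_sq_real, norm_smul, norm_smul,
    real_inner_smul_left, real_inner_smul_right, real_inner_comm (ω x) (fderiv ℝ ω x e),
    norm_inv, norm_norm, Real.norm_eq_abs]
  rw [mul_pow, mul_pow, sq_abs, inv_pow]
  field_simp
  ring

/-- **The exact density is `Dlow[0]`**: at every point of differentiability of `ω`,
`|ω(x)| · |Dξ(x)|²_F = (Σᵢ (|∂ᵢω|²|ω|² − ⟪ω, ∂ᵢω⟫²)) / |ω|³` (both sides vanish where `ω(x) = 0`,
the left one through the factor `|ω(x)|`). [folklore] -/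
theorem norm_mul_frobeniusNormSq_fderiv_vorticityDirection {ω : (EuclideanSpace ℝ (Fin 3)) → (EuclideanSpace ℝ (Fin 3))} {x : (EuclideanSpace ℝ (Fin 3))}
    (h : DifferentiableAt ℝ ω x) :
    ‖ω x‖ * frobeniusNormSq (fderiv ℝ (vorticityDirection ω) x) = ((∑ i, (‖fderiv ℝ ω x ((stdOrthonormalBasis ℝ (EuclideanSpace ℝ (Fin 3))) i)‖ ^ 2 * ‖ω x‖ ^ 2 - ⟪ω x, fderiv ℝ ω x ((stdOrthonormalBasis ℝ (EuclideanSpace ℝ (Fin 3))) i)⟫ ^ 2)) / Real.sqrt (‖ω x‖ ^ 2 + ((0 : ℝ)) ^ 2) ^ 3) := by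
  by_cases hx : ω x = 0
  · simp [hx]
  · unfold frobeniusNormSq
    rw [Finset.mul_sum, regN_zero, Finset.sum_div]
    exact Finset.sum_congr rfl fun i _ => norm_mul_norm_sq_fderiv_vorticityDirection_apply h hx _

/-- Along `εₙ = 1/(n+1)`, `ofReal (Dlow[εₙ]) ↑ ofReal (Dlow[0])`: the supremum of the regularised
lower densities is the exact density. [folklore] -/
theorem iSup_ofReal_dirDissLow_seq (ω : (EuclideanSpace ℝ (Fin 3)) → (EuclideanSpace ℝ (Fin 3))) (x : (EuclideanSpace ℝ (Fin 3))) :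
    ⨆ n : ℕ, ENNReal.ofReal (((∑ i, (‖fderiv ℝ ω x ((stdOrthonormalBasis ℝ (EuclideanSpace ℝ (Fin 3))) i)‖ ^ 2 * ‖ω x‖ ^ 2 - ⟪ω x, fderiv ℝ ω x ((stdOrthonormalBasis ℝ (EuclideanSpace ℝ (Fin 3))) i)⟫ ^ 2)) / Real.sqrt (‖ω x‖ ^ 2 + (((n : ℝ) + 1)⁻¹) ^ 2) ^ 3)) = ENNReal.ofReal (((∑ i, (‖fderiv ℝ ω x ((stdOrthonormalBasis ℝ (EuclideanSpace ℝ (Fin 3))) i)‖ ^ 2 * ‖ω x‖ ^ 2 - ⟪ω x, fderiv ℝ ω x ((stdOrthonormalBasis ℝ (EuclideanSpace ℝ (Fin 3))) i)⟫ ^ 2)) / Real.sqrt (‖ω x‖ ^ 2 + ((0 : ℝ)) ^ 2) ^ 3)) := by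
  have hmono : Monotone fun n : ℕ => ENNReal.ofReal (((∑ i, (‖fderiv ℝ ω x ((stdOrthonormalBasis ℝ (EuclideanSpace ℝ (Fin 3))) i)‖ ^ 2 * ‖ω x‖ ^ 2 - ⟪ω x, fderiv ℝ ω x ((stdOrthonormalBasis ℝ (EuclideanSpace ℝ (Fin 3))) i)⟫ ^ 2)) / Real.sqrt (‖ω x‖ ^ 2 + (((n : ℝ) + 1)⁻¹) ^ 2) ^ 3)) :=
    fun a b hab => ENNReal.ofReal_le_ofReal (monotone_dirDissLow_seq ω x hab)
  have hlim : Tendsto (fun n : ℕ => ENNReal.ofReal (((∑ i, (‖fderiv ℝ ω x ((stdOrthonormalBasis ℝ (EuclideanSpace ℝ (Fin 3))) i)‖ ^ 2 * ‖ω x‖ ^ 2 - ⟪ω x, fderiv ℝ ω x ((stdOrthonormalBasis ℝ (EuclideanSpace ℝ (Fin 3))) i)⟫ ^ 2)) / Real.sqrt (‖ω x‖ ^ 2 + (((n : ℝ) + 1)⁻¹) ^ 2) ^ 3))) atTop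
      (𝓝 (ENNReal.ofReal (((∑ i, (‖fderiv ℝ ω x ((stdOrthonormalBasis ℝ (EuclideanSpace ℝ (Fin 3))) i)‖ ^ 2 * ‖ω x‖ ^ 2 - ⟪ω x, fderiv ℝ ω x ((stdOrthonormalBasis ℝ (EuclideanSpace ℝ (Fin 3))) i)⟫ ^ 2)) / Real.sqrt (‖ω x‖ ^ 2 + ((0 : ℝ)) ^ 2) ^ 3)))) :=
    (ENNReal.continuous_ofReal.tendsto _).comp (tendsto_dirDissLow_seq ω x)
  exact tendsto_nhds_unique (tendsto_atTop_iSup hmono) hlim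

end Pointwise

/-! ### Slice identities: the viscous term, the transport term, the stretching term -/

section Slice

variable {ω : (EuclideanSpace ℝ (Fin 3)) → (EuclideanSpace ℝ (Fin 3))} {φ : (EuclideanSpace ℝ (Fin 3)) → ℝ} {ε : ℝ}

/-- `⟪v, ∇θ(x)⟫ = Dθ(x) v` (Riesz). [folklore] -/
private theorem inner_gradient_eq_fderiv_apply_aux {θ : (EuclideanSpace ℝ (Fin 3)) → ℝ} (x v : (EuclideanSpace ℝ (Fin 3))) :
    ⟪v, gradient θ x⟫ = fderiv ℝ θ x v := by
  rw [gradient, real_inner_comm, InnerProductSpace.toDual_symm_apply]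

/-- Derivative of the quotient `φ/N`, `N = √(|ω|² + ε²)`:
`D(φ/N) v = Dφ v/N − φ ⟪ω, Dω v⟫/N³`. [folklore] -/
theorem fderiv_div_regN_apply (hω : ContDiff ℝ 1 ω) (hφ : ContDiff ℝ 1 φ) (hε : ε ≠ 0)
    (x v : (EuclideanSpace ℝ (Fin 3))) :
    fderiv ℝ (fun y => φ y / Real.sqrt (‖ω y‖ ^ 2 + ε ^ 2)) x v =
      fderiv ℝ φ x v / Real.sqrt (‖ω x‖ ^ 2 + ε ^ 2) - φ x * ⟪ω x, fderiv ℝ ω x v⟫ / Real.sqrt (‖ω x‖ ^ 2 + ε ^ 2) ^ 3 := by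
  have hne : ‖ω x‖ ^ 2 + ε ^ 2 ≠ 0 := by positivity
  have h1 : HasFDerivAt φ (fderiv ℝ φ x) x := (hφ.differentiable one_ne_zero x).hasFDerivAt
  have h2 := hasFDerivAt_inv_regN_comp ((hω.differentiable one_ne_zero x).hasFDerivAt) hne
  have h3 : HasFDerivAt (fun y => φ y * (Real.sqrt (‖ω y‖ ^ 2 + ε ^ 2))⁻¹)
      (φ x • ((-(Real.sqrt (‖ω x‖ ^ 2 + ε ^ 2) ^ 3)⁻¹) • (innerSL ℝ (ω x)).comp (fderiv ℝ ω x)) +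
        (Real.sqrt (‖ω x‖ ^ 2 + ε ^ 2))⁻¹ • fderiv ℝ φ x) x := h1.mul h2
  rw [show (fun y => φ y / Real.sqrt (‖ω y‖ ^ 2 + ε ^ 2)) = fun y => φ y * (Real.sqrt (‖ω y‖ ^ 2 + ε ^ 2))⁻¹ from
    funext fun y => div_eq_mul_inv _ _, h3.fderiv]
  simp
  ring

/-- Derivative of `N − c`, `N = √(|ω|² + ε²)`: `D(N − c) v = ⟪ω, Dω v⟫/N`. [folklore] -/
theorem fderiv_regN_sub_const_apply (hω : ContDiff ℝ 1 ω) (hε : ε ≠ 0) (c : ℝ) (x v : (EuclideanSpace ℝ (Fin 3))) :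
    fderiv ℝ (fun y => Real.sqrt (‖ω y‖ ^ 2 + ε ^ 2) - c) x v = ⟪ω x, fderiv ℝ ω x v⟫ / Real.sqrt (‖ω x‖ ^ 2 + ε ^ 2) := by
  have hne : ‖ω x‖ ^ 2 + ε ^ 2 ≠ 0 := by positivity
  rw [fderiv_sub_const, fderiv_regN_comp_apply (hω.differentiable one_ne_zero x) hne]

/-- **The viscous identity** (Constantin 1990, the computation behind (2.6)–(2.7), with the
direction-dissipation term kept): for `ω ∈ C²`, `φ ∈ C²_c`, `ε ≠ 0`, `N = √(|ω|² + ε²)` and any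
constant `c`,
`∫ φ ⟪ω, Δω⟫/N = −∫ φ · Dreg + ∫ (Δφ)(N − c)`,
`Dreg = Σᵢ (|∂ᵢω|²/N − ⟪ω, ∂ᵢω⟫²/N³)`: integrate by parts once against `ψ = (φ/N) ω`
(`∫⟪Δω, ψ⟫ = −Σᵢ∫⟪∂ᵢω, ∂ᵢψ⟫`), expand `∂ᵢψ`, and integrate the cross term `Σᵢ ∂ᵢφ ∂ᵢN` by parts
once more onto `φ`. [folklore] -/
theorem integral_mul_inner_laplacian_div_regN (hω : ContDiff ℝ 2 ω) (hφ : ContDiff ℝ 2 φ)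
    (hφc : HasCompactSupport φ) (hε : ε ≠ 0) (c : ℝ) :
    ∫ x, φ x * (⟪ω x, (Δ ω) x⟫ / Real.sqrt (‖ω x‖ ^ 2 + ε ^ 2)) =
      -(∫ x, φ x * (∑ i, (‖fderiv ℝ ω x ((stdOrthonormalBasis ℝ (EuclideanSpace ℝ (Fin 3))) i)‖ ^ 2 / Real.sqrt (‖ω x‖ ^ 2 + ε ^ 2) - ⟪ω x, fderiv ℝ ω x ((stdOrthonormalBasis ℝ (EuclideanSpace ℝ (Fin 3))) i)⟫ ^ 2 / Real.sqrt (‖ω x‖ ^ 2 + ε ^ 2) ^ 3))) + ∫ x, (Δ φ) x * (Real.sqrt (‖ω x‖ ^ 2 + ε ^ 2) - c) := by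
  set b := stdOrthonormalBasis ℝ (EuclideanSpace ℝ (Fin 3)) with hb
  -- regularity
  have hω1 : ContDiff ℝ 1 ω := hω.of_le one_le_two
  have hφ1 : ContDiff ℝ 1 φ := hφ.of_le one_le_two
  have hN : ContDiff ℝ 2 fun y => Real.sqrt (‖ω y‖ ^ 2 + ε ^ 2) := (contDiff_regN hε).comp hω
  have hN1 : ContDiff ℝ 1 fun y => Real.sqrt (‖ω y‖ ^ 2 + ε ^ 2) := hN.of_le one_le_two
  have hNne : ∀ y, Real.sqrt (‖ω y‖ ^ 2 + ε ^ 2) ≠ 0 := fun y => (regN_pos hε _).ne'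
  have hq : ContDiff ℝ 1 fun y => φ y / Real.sqrt (‖ω y‖ ^ 2 + ε ^ 2) := hφ1.div hN1 hNne
  set ψ : (EuclideanSpace ℝ (Fin 3)) → (EuclideanSpace ℝ (Fin 3)) := fun y => (φ y / Real.sqrt (‖ω y‖ ^ 2 + ε ^ 2)) • ω y with hψ
  have hψ1 : ContDiff ℝ 1 ψ := hq.smul hω1
  have hψc : HasCompactSupport ψ := by
    refine hφc.mono fun x hx => ?_
    contrapose! hx
    simp [hψ, notMem_support.1 hx]
  -- first integration by parts
  have ibp1 := integral_inner_laplacian_add_eq_zero b hω hψ1 (Or.inr hψc)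
  have hpair : ∀ x, ⟪(Δ ω) x, ψ x⟫ = φ x * (⟪ω x, (Δ ω) x⟫ / Real.sqrt (‖ω x‖ ^ 2 + ε ^ 2)) := fun x => by
    rw [hψ, real_inner_smul_right, real_inner_comm]
    ring
  have hDψ : ∀ x v, fderiv ℝ ψ x v = (φ x / Real.sqrt (‖ω x‖ ^ 2 + ε ^ 2)) • fderiv ℝ ω x v
      + (fderiv ℝ φ x v / Real.sqrt (‖ω x‖ ^ 2 + ε ^ 2) - φ x * ⟪ω x, fderiv ℝ ω x v⟫ / Real.sqrt (‖ω x‖ ^ 2 + ε ^ 2) ^ 3) • ω x := by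
    intro x v
    rw [hψ, fderiv_fun_smul (hq.differentiable one_ne_zero x) (hω1.differentiable one_ne_zero x)]
    simp [fderiv_div_regN_apply hω1 hφ1 hε x v]
  have hterm : ∀ i x, ⟪fderiv ℝ ω x (b i), fderiv ℝ ψ x (b i)⟫ =
      φ x * (‖fderiv ℝ ω x (b i)‖ ^ 2 / Real.sqrt (‖ω x‖ ^ 2 + ε ^ 2)
        - ⟪ω x, fderiv ℝ ω x (b i)⟫ ^ 2 / Real.sqrt (‖ω x‖ ^ 2 + ε ^ 2) ^ 3)
      + fderiv ℝ φ x (b i) * (⟪ω x, fderiv ℝ ω x (b i)⟫ / Real.sqrt (‖ω x‖ ^ 2 + ε ^ 2)) := by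
    intro i x
    rw [hDψ, inner_add_right, real_inner_smul_right, real_inner_smul_right,
      real_inner_self_eq_norm_sq, real_inner_comm (ω x)]
    ring
  -- continuity and integrability
  have hcontω : Continuous ω := hω.continuous
  have hcontDω : ∀ i, Continuous fun x => fderiv ℝ ω x (b i) := fun i =>
    (hω1.continuous_fderiv one_ne_zero).clm_apply continuous_const
  have hcontN : Continuous fun x => Real.sqrt (‖ω x‖ ^ 2 + ε ^ 2) := hN.continuous
  have hcontφ : Continuous φ := hφ.continuous
  have hcontDφ : ∀ i, Continuous fun x => fderiv ℝ φ x (b i) := fun i =>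
    (hφ1.continuous_fderiv one_ne_zero).clm_apply continuous_const
  have hcontq : ∀ i, Continuous fun x => ⟪ω x, fderiv ℝ ω x (b i)⟫ / Real.sqrt (‖ω x‖ ^ 2 + ε ^ 2) := fun i =>
    (hcontω.inner (hcontDω i)).div hcontN hNne
  have hA : ∀ i, Integrable (fun x => φ x * (‖fderiv ℝ ω x (b i)‖ ^ 2 / Real.sqrt (‖ω x‖ ^ 2 + ε ^ 2)
      - ⟪ω x, fderiv ℝ ω x (b i)⟫ ^ 2 / Real.sqrt (‖ω x‖ ^ 2 + ε ^ 2) ^ 3)) := fun i =>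
    (hcontφ.mul ((((hcontDω i).norm.pow 2).div hcontN hNne).sub
      (((hcontω.inner (hcontDω i)).pow 2).div (hcontN.pow 3) fun x => pow_ne_zero 3 (hNne x))))
      |>.integrable_of_hasCompactSupport hφc.mul_right
  have hB : ∀ i, Integrable (fun x => fderiv ℝ φ x (b i) *
      (⟪ω x, fderiv ℝ ω x (b i)⟫ / Real.sqrt (‖ω x‖ ^ 2 + ε ^ 2))) := fun i =>
    ((hcontDφ i).mul (hcontq i)).integrable_of_hasCompactSupport
      (hφc.fderiv_apply (𝕜 := ℝ) (b i)).mul_right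
  -- the sum of the first-order pairings
  have hsum : ∑ i, ∫ x, ⟪fderiv ℝ ω x (b i), fderiv ℝ ψ x (b i)⟫ =
      (∫ x, φ x * (∑ i, (‖fderiv ℝ ω x ((stdOrthonormalBasis ℝ (EuclideanSpace ℝ (Fin 3))) i)‖ ^ 2 / Real.sqrt (‖ω x‖ ^ 2 + ε ^ 2) - ⟪ω x, fderiv ℝ ω x ((stdOrthonormalBasis ℝ (EuclideanSpace ℝ (Fin 3))) i)⟫ ^ 2 / Real.sqrt (‖ω x‖ ^ 2 + ε ^ 2) ^ 3))) +
        ∑ i, ∫ x, fderiv ℝ φ x (b i) * (⟪ω x, fderiv ℝ ω x (b i)⟫ / Real.sqrt (‖ω x‖ ^ 2 + ε ^ 2)) := by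
    have hi : ∀ i, ∫ x, ⟪fderiv ℝ ω x (b i), fderiv ℝ ψ x (b i)⟫ =
        (∫ x, φ x * (‖fderiv ℝ ω x (b i)‖ ^ 2 / Real.sqrt (‖ω x‖ ^ 2 + ε ^ 2)
          - ⟪ω x, fderiv ℝ ω x (b i)⟫ ^ 2 / Real.sqrt (‖ω x‖ ^ 2 + ε ^ 2) ^ 3)) +
        ∫ x, fderiv ℝ φ x (b i) * (⟪ω x, fderiv ℝ ω x (b i)⟫ / Real.sqrt (‖ω x‖ ^ 2 + ε ^ 2)) := fun i => by
      rw [← integral_add (hA i) (hB i)]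
      exact integral_congr_ae (Eventually.of_forall fun x => hterm i x)
    rw [Finset.sum_congr rfl fun i _ => hi i, Finset.sum_add_distrib,
      ← integral_finsetSum _ fun i _ => hA i]
    congr 1
    refine integral_congr_ae (Eventually.of_forall fun x => ?_)
    simp only [Finset.mul_sum, hb]
  -- second integration by parts (scalar, onto `φ`)
  have hNc : ContDiff ℝ 1 fun y => Real.sqrt (‖ω y‖ ^ 2 + ε ^ 2) - c := hN1.sub contDiff_const
  have ibp2 := integral_inner_laplacian_add_eq_zero b (F' := ℝ) hφ hNc (Or.inl hφc)
  have ibp2' : (∫ x, (Δ φ) x * (Real.sqrt (‖ω x‖ ^ 2 + ε ^ 2) - c)) +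
      ∑ i, ∫ x, fderiv ℝ φ x (b i) * (⟪ω x, fderiv ℝ ω x (b i)⟫ / Real.sqrt (‖ω x‖ ^ 2 + ε ^ 2)) = 0 := by
    have e1 : ∫ x, ⟪(Δ φ) x, Real.sqrt (‖ω x‖ ^ 2 + ε ^ 2) - c⟫ = ∫ x, (Δ φ) x * (Real.sqrt (‖ω x‖ ^ 2 + ε ^ 2) - c) :=
      integral_congr_ae (Eventually.of_forall fun x => by simp [mul_comm])
    have e2 : ∀ i, ∫ x, ⟪fderiv ℝ φ x (b i), fderiv ℝ (fun y => Real.sqrt (‖ω y‖ ^ 2 + ε ^ 2) - c) x (b i)⟫ =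
        ∫ x, fderiv ℝ φ x (b i) * (⟪ω x, fderiv ℝ ω x (b i)⟫ / Real.sqrt (‖ω x‖ ^ 2 + ε ^ 2)) := fun i =>
      integral_congr_ae (Eventually.of_forall fun x => by
        beta_reduce
        rw [fderiv_regN_sub_const_apply hω1 hε c x (b i)]
        simp [mul_comm])
    rw [← e1, ← Finset.sum_congr rfl fun i _ => e2 i]
    exact ibp2
  -- assemble
  have e0 : ∫ x, φ x * (⟪ω x, (Δ ω) x⟫ / Real.sqrt (‖ω x‖ ^ 2 + ε ^ 2)) = ∫ x, ⟪(Δ ω) x, ψ x⟫ :=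
    integral_congr_ae (Eventually.of_forall fun x => (hpair x).symm)
  rw [e0]
  linarith [ibp1, hsum, ibp2']

/-- **The transport identity**: for `ω, φ ∈ C¹`, `φ` compactly supported, a divergence-free
`u ∈ C¹`, `ε ≠ 0`, `N = √(|ω|² + ε²)` and any constant `c`,
`∫ φ ⟪ω, (u·∇)ω⟫/N = ∫ φ (u·∇)N = −∫ (N − c) (u·∇)φ`
(`∫ ⟪u, ∇(φ (N − c))⟫ = −∫ φ (N − c) div u = 0`). [folklore] -/
theorem integral_mul_inner_convect_div_regN (hω : ContDiff ℝ 1 ω) (hφ : ContDiff ℝ 1 φ)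
    (hφc : HasCompactSupport φ) (hε : ε ≠ 0) {u : (EuclideanSpace ℝ (Fin 3)) → (EuclideanSpace ℝ (Fin 3))} (hu : ContDiff ℝ 1 u)
    (hdiv : VectorCalculus.IsDivFree u) (c : ℝ) :
    ∫ x, φ x * (⟪ω x, fderiv ℝ ω x (u x)⟫ / Real.sqrt (‖ω x‖ ^ 2 + ε ^ 2)) =
      -∫ x, (Real.sqrt (‖ω x‖ ^ 2 + ε ^ 2) - c) * fderiv ℝ φ x (u x) := by
  have hN1 : ContDiff ℝ 1 fun y => Real.sqrt (‖ω y‖ ^ 2 + ε ^ 2) := (contDiff_regN hε).comp hω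
  have hNne : ∀ y, Real.sqrt (‖ω y‖ ^ 2 + ε ^ 2) ≠ 0 := fun y => (regN_pos hε _).ne'
  have hNc : ContDiff ℝ 1 fun y => Real.sqrt (‖ω y‖ ^ 2 + ε ^ 2) - c := hN1.sub contDiff_const
  set θ : (EuclideanSpace ℝ (Fin 3)) → ℝ := fun y => φ y * (Real.sqrt (‖ω y‖ ^ 2 + ε ^ 2) - c) with hθ
  have hθ1 : ContDiff ℝ 1 θ := hφ.mul hNc
  have hθc : HasCompactSupport θ := hφc.mul_right
  have h := integral_mul_divergence_add_eq_zero_left hθ1 hu hθc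
  have hdiv0 : ∫ x, θ x * VectorCalculus.divergence u x = 0 := by
    simp [hdiv _]
  rw [hdiv0, zero_add] at h
  have hDθ : ∀ x, ⟪u x, gradient θ x⟫ =
      (Real.sqrt (‖ω x‖ ^ 2 + ε ^ 2) - c) * fderiv ℝ φ x (u x) + φ x * (⟪ω x, fderiv ℝ ω x (u x)⟫ / Real.sqrt (‖ω x‖ ^ 2 + ε ^ 2)) := by
    intro x
    rw [inner_gradient_eq_fderiv_apply_aux, hθ,
      fderiv_fun_mul (hφ.differentiable one_ne_zero x) (hNc.differentiable one_ne_zero x)]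
    simp [fderiv_regN_sub_const_apply hω hε c x (u x)]
    ring
  simp_rw [hDθ] at h
  -- integrability of the two pieces
  have hcontω : Continuous ω := hω.continuous
  have hcontN : Continuous fun x => Real.sqrt (‖ω x‖ ^ 2 + ε ^ 2) := hN1.continuous
  have hi₁ : Integrable fun x => (Real.sqrt (‖ω x‖ ^ 2 + ε ^ 2) - c) * fderiv ℝ φ x (u x) := by
    refine ((hcontN.sub continuous_const).mul
      ((hφ.continuous_fderiv one_ne_zero).clm_apply hu.continuous)).integrable_of_hasCompactSupport ?_
    refine (hφc.fderiv (𝕜 := ℝ)).mono fun x hx => ?_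
    contrapose! hx
    simp only [mem_support, not_not] at hx
    simp [hx]
  have hi₂ : Integrable fun x => φ x * (⟪ω x, fderiv ℝ ω x (u x)⟫ / Real.sqrt (‖ω x‖ ^ 2 + ε ^ 2)) :=
    (hφ.continuous.mul ((hcontω.inner ((hω.continuous_fderiv one_ne_zero).clm_apply
      hu.continuous)).div hcontN hNne)).integrable_of_hasCompactSupport hφc.mul_right
  rw [integral_add hi₁ hi₂] at h
  linarith

/-- **The stretching bound** (Constantin 1990, (2.7): `(ω·∇u)·ω/|ω| ≤ |∇u| |ω|`, here with the
symmetric/antisymmetric refinement giving the dissipation density): for `ω = curl v`, `φ ≥ 0`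
and any `ε`, `|φ ⟪ω, (ω·∇)v⟫/N| ≤ φ |∇v|²_F`, `N = √(|ω|² + ε²) ≥ |ω|`. [folklore] -/
theorem abs_mul_inner_stretch_div_regN_le (v : (EuclideanSpace ℝ (Fin 3)) → (EuclideanSpace ℝ (Fin 3))) (x : (EuclideanSpace ℝ (Fin 3))) {a : ℝ} (ha : 0 ≤ a) (ε : ℝ) :
    |a * (⟪curl v x, fderiv ℝ v x (curl v x)⟫ / Real.sqrt (‖curl v x‖ ^ 2 + ε ^ 2))| ≤
      a * frobeniusNormSq (fderiv ℝ v x) := by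
  have hF := frobeniusNormSq_nonneg (fderiv ℝ v x)
  rw [abs_mul, abs_of_nonneg ha]
  refine mul_le_mul_of_nonneg_left ?_ ha
  rcases eq_or_lt_of_le (regN_nonneg ε (curl v x)) with hN | hN
  · rw [← hN, div_zero, abs_zero]
    exact hF
  · rw [abs_div, abs_of_pos hN, div_le_iff₀ hN]
    calc |⟪curl v x, fderiv ℝ v x (curl v x)⟫|
        ≤ ‖curl v x‖ * frobeniusNormSq (fderiv ℝ v x) := abs_inner_curl_convect_le v x
      _ ≤ Real.sqrt (‖curl v x‖ ^ 2 + ε ^ 2) * frobeniusNormSq (fderiv ℝ v x) := by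
        gcongr
        exact norm_le_regN ε _
      _ = frobeniusNormSq (fderiv ℝ v x) * Real.sqrt (‖curl v x‖ ^ 2 + ε ^ 2) := mul_comm _ _

end Slice

end Literature.Analysis.FluidPDE
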